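import Mathlib

/-!
# Crux `MatrixDescartes` (stmt-ValiantsHypothesis-18050), line `Lift` — registered stub `stub_arith`

The ARITHMETIC of the transfer `(c, q, K) ↦ (c + 2, 3q, 2K)` used by the PSD lift
(`Lines/Lift.lean`, composition `MatrixDescartes_of`):

* SIZE bookkeeping (`StubArith.size_arith`): with `L = ⌊log₂ K⌋`, `L + 1 = ⌊log₂ 2K⌋` and
  `c' = c + 2`, the lifted size `m (K + 1) ≤ 2^((L + c)^c) · 2^(L + 1)` fits under
  `2^((L + 1 + c')^c')` because `L + 1 + (L + c)^c ≤ (L + c + 3)^(c + 2)`.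
  Proof: `(L + c + 3)^(c + 2) = (L + c + 3)^c · (L + c + 3)^2 ≥ (L + c)^c · 3 (L + 3)
  ≥ 3 L + 9 (L + c)^c ≥ L + 1 + (L + c)^c` (as `(L + c)^c ≥ 1`).
* ZERO-COUNT bookkeeping (`StubArith.count_arith`): for `K ≥ 4`, `⌊log₂ 2K⌋ = ⌊log₂ K⌋ + 1`
  (`Nat.log_mul_base`) and `⌊log₂ K⌋ ≥ 2`, so `2K (⌊log₂ K⌋ + 1) ≤ 3 K ⌊log₂ K⌋`; hence
  `(Z^q)^3 = Z^{3q} ≤ 2^{2K ⌊log₂ 2K⌋} ≤ (2^{K ⌊log₂ K⌋})^3`, and cubes are monotone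
  (`Nat.pow_le_pow_iff_left`).

Elementary; Mathlib only (axioms `propext`, `Classical.choice`, `Quot.sound`).
-/

-- layout Summits/ValiantsHypothesis/ValiantsHypothesis forces the duplicated namespace component
set_option linter.dupNamespace false

namespace Summit.ValiantsHypothesis.ValiantsHypothesis.Theorems.LacunarySymmetroidMatrixDescartes

namespace StubArith

/-- SIZE bookkeeping of the lift: `L + 1 + (L + c)^c ≤ (L + 1 + (c + 2))^(c + 2)`. -/
theorem size_arith (c L : ℕ) : L + 1 + (L + c) ^ c ≤ (L + 1 + (c + 2)) ^ (c + 2) := by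
  -- `x := (L + c)^c ≥ 1`, `y := (L + 1 + (c + 2))^2 ≥ 3 L + 9`, and `x ≤ (L + 1 + (c + 2))^c`.
  have hx : 1 ≤ (L + c) ^ c := by
    rcases Nat.eq_zero_or_pos c with rfl | hc
    · simp
    · exact Nat.one_le_pow _ _ (by omega)
  have hxc : (L + c) ^ c ≤ (L + 1 + (c + 2)) ^ c := Nat.pow_le_pow_left (by omega) c
  have hy : 3 * L + 9 ≤ (L + 1 + (c + 2)) ^ 2 := by
    rw [pow_two]
    calc 3 * L + 9 = (L + 3) * 3 := by ring
      _ ≤ (L + 1 + (c + 2)) * (L + 1 + (c + 2)) := Nat.mul_le_mul (by omega) (by omega)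
  have h1 : (L + c) ^ c * (3 * L + 9) ≤ (L + c) ^ c * (L + 1 + (c + 2)) ^ 2 :=
    Nat.mul_le_mul_left _ hy
  have h2 : 1 * (3 * L) ≤ (L + c) ^ c * (3 * L) := Nat.mul_le_mul_right _ hx
  calc L + 1 + (L + c) ^ c ≤ (L + c) ^ c * (3 * L + 9) := by nlinarith [h2]
    _ ≤ (L + c) ^ c * (L + 1 + (c + 2)) ^ 2 := h1
    _ ≤ (L + 1 + (c + 2)) ^ c * (L + 1 + (c + 2)) ^ 2 := Nat.mul_le_mul_right _ hxc
    _ = (L + 1 + (c + 2)) ^ (c + 2) := (pow_add _ _ _).symm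

/-- For `K ≥ 4` (indeed `K ≠ 0`): `⌊log₂ (K + K)⌋ = ⌊log₂ K⌋ + 1`. -/
theorem log_two_add_self (K : ℕ) (hK : K ≠ 0) : Nat.log 2 (K + K) = Nat.log 2 K + 1 := by
  rw [← mul_two]
  exact Nat.log_mul_base one_lt_two hK

/-- For `K ≥ 4`: `2 ≤ ⌊log₂ K⌋`. -/
theorem two_le_log_two {K : ℕ} (hK : 4 ≤ K) : 2 ≤ Nat.log 2 K :=
  Nat.le_log_of_pow_le one_lt_two (by simpa using hK)

/-- The exponent comparison `(K + K) ⌊log₂ (K + K)⌋ ≤ 3 (K ⌊log₂ K⌋)` for `K ≥ 4`. -/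
theorem exp_le {K : ℕ} (hK : 4 ≤ K) :
    (K + K) * Nat.log 2 (K + K) ≤ 3 * (K * Nat.log 2 K) := by
  rw [log_two_add_self K (by omega)]
  have h := Nat.mul_le_mul_left K (two_le_log_two hK)
  nlinarith [h]

/-- ZERO-COUNT bookkeeping of the lift: for `K ≥ 4`,
`Z^{3q} ≤ 2^{(K + K) ⌊log₂ (K + K)⌋} → Z^q ≤ 2^{K ⌊log₂ K⌋}`. -/
theorem count_arith (K Z q : ℕ) (hK : 4 ≤ K)
    (h : Z ^ (3 * q) ≤ 2 ^ ((K + K) * Nat.log 2 (K + K))) :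
    Z ^ q ≤ 2 ^ (K * Nat.log 2 K) := by
  have h3 : (Z ^ q) ^ 3 ≤ (2 ^ (K * Nat.log 2 K)) ^ 3 :=
    calc (Z ^ q) ^ 3 = Z ^ (3 * q) := (pow_mul' Z 3 q).symm
      _ ≤ 2 ^ ((K + K) * Nat.log 2 (K + K)) := h
      _ ≤ 2 ^ (3 * (K * Nat.log 2 K)) := Nat.pow_le_pow_right (by norm_num) (exp_le hK)
      _ = (2 ^ (K * Nat.log 2 K)) ^ 3 := pow_mul' 2 3 _
  exact (Nat.pow_le_pow_iff_left (by norm_num)).1 h3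

end StubArith

/-- **Registered stub `stub_arith`** (arithmetic of the transfer `(c, q, K) ↦ (c + 2, 3q, 2K)`):
the size bookkeeping `L + 1 + (L + c)^c ≤ (L + 1 + (c + 2))^(c + 2)` and the zero-count
bookkeeping `Z^{3q} ≤ 2^{2K ⌊log₂ 2K⌋} → Z^q ≤ 2^{K ⌊log₂ K⌋}` for `K ≥ 4`. -/
theorem stub_arith :
    (∀ c L : ℕ, L + 1 + (L + c) ^ c ≤ (L + 1 + (c + 2)) ^ (c + 2)) ∧
    (∀ K Z q : ℕ, 4 ≤ K → Z ^ (3 * q) ≤ 2 ^ ((K + K) * Nat.log 2 (K + K)) →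
        Z ^ q ≤ 2 ^ (K * Nat.log 2 K)) :=
  ⟨StubArith.size_arith, StubArith.count_arith⟩

end Summit.ValiantsHypothesis.ValiantsHypothesis.Theorems.LacunarySymmetroidMatrixDescartes
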